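import Summits.MatrixMultiplication.MatrixMultiplication.Theorems.SoloInformedCwTwoShadowCharTwo
import Summits.MatrixMultiplication.MatrixMultiplication.Theorems.SoloInformedCwTwoNormalForms
import Summits.MatrixMultiplication.MatrixMultiplication.Theorems.SoloInformedCwTwoClassReps
import HarnessLib

/-!
# `P ⊵ N_k` over a field iff `char ≠ 2`, for eight classes (solo-informed, gen 25)

Corollary file of the §2n series.  For the eight Nurmiev classes
`k ∈ {6, 7, 10, 12, 14, 15, 16, 22}` the landed census certificate `P ⊵ N_k` has a multiplier that is a
power of `2` (`2, 4, 4, 2, ·, 2, 2, 4`; for `N₁₄` we go through `T_{K[x,y]/𝔪²}`, multiplier `2`, and its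
multiplier-`1` isomorphism with `N₁₄`), while `SoloInformedCwTwoShadowCharTwo` shows `P ⋭ N_k` whenever
`2 = 0`.  Hence over a FIELD `K`:

  `P ⊵ N_k  ⟺  (2 : K) ≠ 0`   (`sThree_polyDegeneratesTo_nurmiev_iff_two_ne_zero`),

the exact analogue of the landed statements for `T₂` (`sThree_polyDegeneratesTo_tTwo_iff`) and
`T_{K[x,y]/𝔪²}` (`sThree_polyDegeneratesTo_nullAlg_iff`).  For the other eight obstructed boundary
classes (`N₃, N₅, N₈, N₉, N₁₁, N₁₃, N₁₈` and, outside the boundary, `N₁, N₂, N₄`) the landed multipliers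
carry odd primes (`48, 24, 6, ·, 12, 12, 250`), so only the direction `2 = 0 ⇒ P ⋭ N_k` is recorded.
-/

namespace Summit.MatrixMultiplication.MatrixMultiplication.Theorems

open Literature.Computability.AlgebraicComplexity
open Literature.Barriers.MatrixMultiplication (PolyDegeneratesTo)

/-- **`P ⊵ N_k` over any field with `2 ≠ 0`, for `k ∈ {6, 7, 10, 12, 14, 15, 16, 22}`.** -/
theorem sThree_polyDegeneratesTo_nurmiev_of_two_ne_zero (K : Type*) [Field K] (h2 : (2 : K) ≠ 0)
    (k : ℕ) (hk : k ∈ ({6, 7, 10, 12, 14, 15, 16, 22} : Finset ℕ)) :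
    PolyDegeneratesTo (sThree K) (nurmiev K k) := by
  have hD2 : IsUnit (((2 : ℤ) : K)) := by
    rw [Int.cast_ofNat]
    exact isUnit_iff_ne_zero.mpr h2
  have hD4 : IsUnit (((4 : ℤ) : K)) := by
    rw [Int.cast_ofNat]
    refine isUnit_iff_ne_zero.mpr ?_
    have h4 : (4 : K) = 2 * 2 := by norm_num
    rw [h4]
    exact mul_ne_zero h2 h2
  simp only [Finset.mem_insert, Finset.mem_singleton] at hk
  rcases hk with rfl | rfl | rfl | rfl | rfl | rfl | rfl | rfl
  · exact DegenCert.polyDegeneratesTo_of_check K sThree_nurmiev_6_check hD2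
  · exact DegenCert.polyDegeneratesTo_of_check K sThree_nurmiev_7_check hD4
  · exact DegenCert.polyDegeneratesTo_of_check K sThree_nurmiev_10_check hD4
  · exact DegenCert.polyDegeneratesTo_of_check K sThree_nurmiev_12_check hD2
  · -- `N₁₄` through `T_{K[x,y]/𝔪²}` (multiplier `2`) and its isomorphism with `N₁₄` (multiplier `1`)
    have h1 := polyDegeneratesTo_swap₁₂ (sThree_polyDegeneratesTo_nullAlg K h2)
    rw [sThree_swap₁₂] at h1
    exact h1.trans (DegenCert.polyDegeneratesTo_of_check_one K nullAlg_iso_nurmiev_14_check)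
  · exact DegenCert.polyDegeneratesTo_of_check K sThree_nurmiev_15_check hD2
  · exact DegenCert.polyDegeneratesTo_of_check K sThree_nurmiev_16_check hD2
  · exact DegenCert.polyDegeneratesTo_of_check K sThree_nurmiev_22_check hD4

/-- **`P ⊵ N_k ⟺ char K ≠ 2`** over a field, for `k ∈ {6, 7, 10, 12, 14, 15, 16, 22}`. -/
theorem sThree_polyDegeneratesTo_nurmiev_iff_two_ne_zero (K : Type*) [Field K] (k : ℕ)
    (hk : k ∈ ({6, 7, 10, 12, 14, 15, 16, 22} : Finset ℕ)) :
    PolyDegeneratesTo (sThree K) (nurmiev K k) ↔ (2 : K) ≠ 0 := by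
  refine ⟨fun h h2 => ?_, fun h2 => sThree_polyDegeneratesTo_nurmiev_of_two_ne_zero K h2 k hk⟩
  have hk' : k ∈ ({1, 2, 3, 4, 5, 6, 7, 8, 10, 11, 12, 13, 14, 15, 16, 22} : Finset ℕ) := by
    simp only [Finset.mem_insert, Finset.mem_singleton] at hk
    rcases hk with rfl | rfl | rfl | rfl | rfl | rfl | rfl | rfl <;> decide
  exact not_sThree_polyDegeneratesTo_nurmiev_of_mem_of_two_eq_zero K h2 k hk' h

end Summit.MatrixMultiplication.MatrixMultiplication.Theorems
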